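import Summits.ResolutionOfSingularities.ResolutionOfSingularities.Theorems.HilbertSamuelEliminationSigmaMaxModificationsCorridor3SigmaRowRunPChartEta
import Summits.ResolutionOfSingularities.ResolutionOfSingularities.Theorems.HilbertSamuelEliminationSigmaMaxModificationsCorridor3SigmaRowRunPFrameGoodLawsT
import HarnessLib

/-!
# [OURS · L1 W4.2] ENGINE-I «ROW-P» — THE INSTANCE, FILE D2b (kernel lane): the GLOBAL `T`-guarded law `η ≤ 3` of `guardedLawsT_incidenceGood` FROM A COVER OF
# THE ROW STRATUM BY FIRST-LAYER CONTACT CHARTS (FILE D2a point-wise ∘ the cover), and the `GuardedLawsT` assembly with that binder discharged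
# (cell res-hironaka, LADDER-RESOLUTION rung L; slot W4.2, crux chain w42 `SigmaMaxModificationsCorridor3` stmt-ResolutionOfSingularities-19249 / crux
# stmt-…-18506; RULING v3.14-51a (51a-F); res-L1-w42-tri-2 B-2 / tri-1 22:25:59Z (ii)(iii); seat res-D-pv-060 g9; `--supports stmt-…-19249 --as helper`, counted 0)

HONEST FRAMING. OURS proof bookkeeping over D2a (`RowChart.eta_le_three`) and C″ (`RowEngine.guardedLawsT_incidenceGood`). Nothing here is a statement of H.
Hironaka's manuscript [Hironaka2017] (CANDIDATE, never a premise) nor of [Cutkosky2009]. Every declaration a PROVED `theorem`. AI-written, weaker than expert review.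

* **`RowEngine.eta_le_three_of_charts`** — if every point of the row stratum of every good state lies in the open of SOME first-layer chart `c : RowChart k m S₀ s`
  at which the restricted old epoch has no repeated member through the point and `spanFinrank 𝔪 ≤ 4` (the regular four-fold ambient; tri-1 (ii): both belong to
  the scope / the D3 cover input), then `η ≤ 3` on `T` — the `eta_le_three` binder of `guardedLawsT_incidenceGood`, DISCHARGED from the cover.
* **`RowEngine.guardedLawsT_incidenceGood_of_charts`** — the `T`-guarded laws of the scoped instance with `η ≤ 3` supplied by the cover: FOUR named laws remain
  (`dbl_map`, `Eminus_map`, `surf_map`, `freeCurve_map`) + `curveComp_nonempty` (a law OF the readings).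

References: Cutkosky 2009, Def. 5.4 («η»), Thm 7.2 [Cutkosky2009] (shape only); BGMW 2011 Def. 3.1.1 [BierstoneGrigorievMilmanWlodarczyk2011].
-/

set_option linter.dupNamespace false -- mandated namespace of this single-conjunct summit

noncomputable section

open CategoryTheory AlgebraicGeometry TopologicalSpace IsLocalRing
open Literature.AlgebraicGeometry.Resolution
open Summit.ResolutionOfSingularities.ResolutionOfSingularities.Theorems.SigmaMaxModificationsCorridor3.Sigma

namespace Summit.ResolutionOfSingularities.ResolutionOfSingularities.Theorems.SigmaMaxModificationsCorridor3.RowRunP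

universe u

namespace RowEngine

variable {m S₀ : ℕ} (eng : RowEngine.{u} m S₀) (rd : RowReadings.{u}) (sc : eng.Scope) (k : Type u) [Field k]

/-- **`η ≤ 3` ON THE ROW STRATUM FROM A COVER BY FIRST-LAYER CHARTS** (D2a point-wise). [cite: Cutkosky2009, Def. 5.4 («η»)] -/
theorem eta_le_three_of_charts
    (hcov : ∀ (s : (RowRunFrame.ofRowGood m S₀ eng sc).St) (x : s.1.W), x ∈ s.1.T m S₀ →
      ∃ (c : RowChart k m S₀ s.1) (x' : (c.ch.U : Scheme.{u})), c.ch.U.ι.base x' = x ∧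
        (membersThrough (s.1.Eminus.map fun B => B.comap c.ch.U.ι) x').Nodup ∧
        (maximalIdeal ((c.ch.U : Scheme.{u}).presheaf.stalk x')).spanFinrank ≤ 4)
    (s : (RowRunFrame.ofRowGood m S₀ eng sc).St) (x : ULift.{u + 1} s.1.W) (hx : x ∈ (RowRunFrame.ofRowGood m S₀ eng sc).T s) :
    s.1.eta x ≤ 3 := by
  obtain ⟨c, x', hx', hnodup, hdim⟩ := hcov s x.down hx
  have hxT : c.ch.U.ι.base x' ∈ s.1.T m S₀ := by rw [hx']; exact hx
  have h := c.eta_le_three x' hxT hnodup hdim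
  have hxe : (⟨c.ch.U.ι.base x'⟩ : ULift.{u + 1} s.1.W) = x := by rw [hx']
  rwa [hxe] at h

/-- [OURS · L1 W4.2] **THE `T`-GUARDED LAWS OF THE SCOPED INSTANCE WITH `η ≤ 3` DISCHARGED FROM A CHART COVER** — four geometric laws named (+ the readings'
`curveComp_nonempty`). [cite: Cutkosky2009, Def. 5.5, Lemma 5.1 (1), Thm 7.2] -/
theorem guardedLawsT_incidenceGood_of_charts
    (hcov : ∀ (s : (RowRunFrame.ofRowGood m S₀ eng sc).St) (x : s.1.W), x ∈ s.1.T m S₀ →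
      ∃ (c : RowChart k m S₀ s.1) (x' : (c.ch.U : Scheme.{u})), c.ch.U.ι.base x' = x ∧
        (membersThrough (s.1.Eminus.map fun B => B.comap c.ch.U.ι) x').Nodup ∧
        (maximalIdeal ((c.ch.U : Scheme.{u}).presheaf.stalk x')).spanFinrank ≤ 4)
    (dbl_map : ∀ {s s' : (RowRunFrame.ofRowGood m S₀ eng sc).St} (h : (RowRunFrame.ofRowGood m S₀ eng sc).Move s s')
      (D' : Set (ULift.{u + 1} s'.1.W)), D' ∈ rd.dblCurves s'.1 → (D' ∩ (RowRunFrame.ofRowGood m S₀ eng sc).T s').Nonempty →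
      ∃ D ∈ rd.dblCurves s.1, (RowRunFrame.ofRowGood m S₀ eng sc).ptMap h '' D' = D)
    (Eminus_map : ∀ {s s' : (RowRunFrame.ofRowGood m S₀ eng sc).St} (h : (RowRunFrame.ofRowGood m S₀ eng sc).Move s s')
      (Fc' : Set (ULift.{u + 1} s'.1.W)), Fc' ∈ s'.1.eminusLive → (Fc' ∩ (RowRunFrame.ofRowGood m S₀ eng sc).T s').Nonempty →
      ∃ Fc ∈ s.1.eminusLive, (RowRunFrame.ofRowGood m S₀ eng sc).ptMap h '' Fc' = Fc)
    (surf_map : ∀ {s s' : (RowRunFrame.ofRowGood m S₀ eng sc).St} (h : (RowRunFrame.ofRowGood m S₀ eng sc).Move s s')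
      (S' : Set (ULift.{u + 1} s'.1.W)), S' ∈ rd.surfCompsIn s'.1 ((RowRunFrame.ofRowGood m S₀ eng sc).T s') →
      (RowRunFrame.ofRowGood m S₀ eng sc).ptMap h '' S' ∈ rd.surfCompsIn s.1 ((RowRunFrame.ofRowGood m S₀ eng sc).T s))
    (freeCurve_map : ∀ {s s' : (RowRunFrame.ofRowGood m S₀ eng sc).St} (h : (RowRunFrame.ofRowGood m S₀ eng sc).Move s s')
      (C' : Set (ULift.{u + 1} s'.1.W)), C' ∈ (eng.incidenceGood rd sc).freeCurves s' →
      ¬ (rd.surfCompsIn s.1 ((RowRunFrame.ofRowGood m S₀ eng sc).T s)).Nonempty →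
      (RowRunFrame.ofRowGood m S₀ eng sc).ptMap h '' C' ∈ rd.curveCompsIn s.1 ((RowRunFrame.ofRowGood m S₀ eng sc).T s))
    (curveComp_nonempty : ∀ (s : (RowRunFrame.ofRowGood m S₀ eng sc).St) (A C : Set (ULift.{u + 1} s.1.W)), C ∈ rd.curveCompsIn s.1 A → C.Nonempty) :
    (eng.incidenceGood rd sc).toPIncidence.GuardedLawsT :=
  eng.guardedLawsT_incidenceGood rd sc (eng.eta_le_three_of_charts sc k hcov) dbl_map Eminus_map surf_map freeCurve_map curveComp_nonempty

end RowEngine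

end Summit.ResolutionOfSingularities.ResolutionOfSingularities.Theorems.SigmaMaxModificationsCorridor3.RowRunP

end
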